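import Summits.BirchSwinnertonDyer.BirchSwinnertonDyer.Theorems.TwoAdicConverseLambdaHalfTowerDoor
import Summits.BirchSwinnertonDyer.BirchSwinnertonDyer.Theorems.ByReductionTypeAtTwoOrdRedTowerGap
import Summits.BirchSwinnertonDyer.BirchSwinnertonDyer.Theorems.ByReductionTypeAtTwoOrdKatoReserveDefs
import HarnessLib

/-!
# Route `TwoAdicConverse` (rung S3), crux `OrdLambdaHalfAtTwo` (item 19556): the KATO-HALF DOOR of the `λ`-half —
# the Euler-system direction AT a curve plus two finite certificates gives the Eisenstein `λ`-inequality, with NO tower gap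

Cell `bsd-2adic` (run/shared/lean/pub/bsd-2adic/), seat `bsd-2adic-conv-1x` (WIDTH-LEVER second lane on item 19556, GEN 3;
director-bsd g8 2026-08-27T10:49:05Z «aggregate the class-level `λ`-certificates at `2` under a uniform parity/`λ`-invariant
argument»). THEOREMS ONLY — no definition, no named fact, no axiom, no `sorry`.

WHY. After GEN 0 (tower doors, p527205) and GEN 2 (Greenberg–Vatsal transport, p539793) the S3 census residue WITHOUT any row is
exactly the `λ`-SATURATED `E[2]`-irreducible block of the K4 residue (29 classes, `plan/offer-tower/OPEN65-after-R684.v2.tsv`,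
seat ord-2 MEMO-6): for 11 of them the layer count ALREADY reaches `λ_an` (`d_J ≥ λ_an` in tower/TABLE-TOWER-E1-slim.tsv:
`219725r 288855s 488965b 251493a 300219c 375411g 407305e 445851o 65797a` at `J = 3`, `394781b 293355c` at `J = 2`), and the
ONLY missing input of the tower door `lambdaHalfAtTwo_of_towerGap_of_layerSelmer_of_abbesUllmo` is the TOWER GAP
(`TowerGapAtTwo W` ⟺ `X(E/ℚ_∞)` torsion ∧ `μ(X) = 0`), which for these classes needs a layer-`≥ 4` descent (MEMO-6: no layer-`≤ 3`
datum separates `μ = 0` from `μ > 0`). This file replaces the gap by the KATO HALF AT THE CURVE: seat ord's door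
`OrdRedAtTwo.towerGapAtTwo_of_mainConjectureLowerDivisibilityAtTwoOrd_of_analyticMuLE` (p533609; any residual image) reads
`X` torsion from Kato 17.4 (1)(2)@2 (`h17`) and `μ(X) = 0` from `char_Λ X ∋ g`, `ι g = ϖ·L₂(f,α)` (the item
`X5.O1.MainConjectureLowerDivisibilityAtTwoOrd W` = K4's crux `OrdKatoHalfAtTwo`, item 19271, AT `W`) plus the certificate `μ_an = 0`
(`AnalyticMuLE W 2 0`); composing with the GEN 0 door gives

* §1 `lambdaHalfAtTwo_of_katoHalf_of_analyticMuLE_of_layerSelmer[_of_abbesUllmo]` — PRINT {`hmod`, `h17`, Greenberg 4.14@2 `h414`,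
  Abbes–Ullmo `hAU` | displayed `hper₀`} + the Kato half AT `W` BY NAME (`hK`) + CERT {`μ_an = 0`, `2^n ≤ #Sel_{2^∞}(E/ℚ_j)[2]`,
  `λ_an = n`} ⟹ `LambdaHalfAtTwo W`; tower-currency twin `…_of_towerRank_of_abbesUllmo`. NO tower gap, NO upper count, NO GRH
  question (a LOWER count is a list of exhibited Selmer elements), NO Greenberg 4.1, NO GZK, NO `Ш` datum.
* §2 the same with the Kato half supplied by K4's displayed binders on the `2`-adically SURJECTIVE habitat (seat ord GEN 8/9,
  `ByReductionTypeAtTwoOrdKato{Int,Reserve}Defs.lean`): `…_of_katoReserveWK2_of_Δ_neg` (RESERVE tier: W_K2 Thm. B, review UPHELD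
  2026-08-07 — at `Δ < 0` it IS the sharp Kato half) and `…_of_katoInt` (RESERVE + CELL-MEMO-6 tier, either sign). At `Δ > 0` the
  reserve binder alone gives only `char X ∣ 2·ϖ·L₂`, i.e. `μ(X) ≤ 1`, which does NOT feed the count — hence the sharp binder there.
* §3 for the K4 seats, the same composition one step further: Kato half AT `W` + CERT {`μ_an = 0`, saturating count, `λ_an`} ⟹
  `MazurMainConjecture W 2` (`KatoHalfPinch.mazurMainConjecture_two_of_towerGap_of_layerSelmer` with the gap struck) — the `2`-adic
  main conjecture AT the curve from ONE divisibility and two finite certificates, no layer-`4` descent.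

READING. On the `E[2]`-irreducible block S3's item 19556 AT a member REDUCES to K4's item 19271 AT that member plus two finite
certificates the cell already holds for all 611 good-ordinary classes (`μ_an`, `λ_an`: CERT-ORD-OPEN528 two-engine) and one it
holds wherever the tower count saturates (`d_J ≥ λ_an`). The Euler-system half implies the Eisenstein `λ`-half, class by class.

HONEST FRAMING. Class-level doors: they conclude `LambdaHalfAtTwo W` for ONE `W`; item 19556 (= the `λ`-part of the `2`-adic main
conjecture on «non-CM, good ordinary at `2`») stays OPEN at the `∀`-level; the Kato half AT `W` is DISPLAYED (by name, or through a
RESERVE / CELL-MEMO binder that is NOT in print at `p = 2`), never proved here; nothing is booked (S3 rows are structure); BSD is not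
proved by any of this. PARTITION (D-0054): none — RANK axis (S3); companion formula cell X5@2 good-ord, the `openirr` NO-FILE block
(B1·O1); types-the-object-of (doors); closes none; bears_on: S3 (19556), K4 FYI (19271/19573 at the same members: §3).

References: K. Kato, Astérisque 295 (2004), Thm. 17.4 [Kato2004Asterisque]; R. Greenberg, LNM 1716 (1999), §1 p. 60, §3 pp. 85–86,
Prop. 4.14 [GreenbergLNM1716]; R. Greenberg, V. Vatsal, Invent. Math. 142 (2000), p. 4 [GreenbergVatsal2000]; A. Abbes, E. Ullmo,
Compositio 103 (1996), Thm. A [AbbesUllmo1996]; L. Washington, GTM 83, §13.2 [Washington1997]; K. Rubin, Euler Systems (2000),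
Thm. II.3.8 [Rubin2000]; T. Dokchitser, V. Dokchitser, Math. Z. 272 (2012), Theorem [DokchitserDokchitserMathZ2012].
-/

set_option linter.dupNamespace false
set_option autoImplicit false

noncomputable section

open scoped Classical MatrixGroups ModularForm
open NumberField IsDedekindDomain CongruenceSubgroup WeierstrassCurve PowerSeries Literature.NumberTheory.EllipticCurves
  Literature.NumberTheory.EllipticCurves.ModularForms Literature.NumberTheory.EllipticCurves.Rank1Residual
  Literature.NumberTheory.EllipticCurves.Rank1Residual.Typed
  Literature.NumberTheory.EllipticCurves.Greenberg1999
  Literature.NumberTheory.EllipticCurves.GreenbergVatsal2000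
  Summit.BirchSwinnertonDyer.Rank1Residual.X1.MuLambda Summit.BirchSwinnertonDyer.Rank1Residual.X1.MuPart
  Summit.BirchSwinnertonDyer.Rank1Residual.X1.ParitySqueeze
  Summit.BirchSwinnertonDyer.BirchSwinnertonDyer.Theorems.Rank1ResidualX1Defs
  Summit.BirchSwinnertonDyer.Rank1Residual.X5 Summit.BirchSwinnertonDyer.Rank1Residual.X5.O1
  Summit.BirchSwinnertonDyer.Rank1Residual.X5.TowerGap Summit.BirchSwinnertonDyer.Rank1Residual
  Summit.BirchSwinnertonDyer.BirchSwinnertonDyer.Theorems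

namespace Summit.BirchSwinnertonDyer.BirchSwinnertonDyer.Theorems.TwoAdicTwistConverse

variable (W : WeierstrassCurve ℚ) [W.IsElliptic] [W.IsGloballyMinimal]

/-! ## §1 The Kato-half door, Kato half BY NAME (item 19271 AT the curve) -/

/-- **KATO-HALF DOOR of the `λ`-half (layer currency, odd torsion).** `W/ℚ` globally minimal elliptic, good ordinary at `2`,
`2 ∤ #E(ℚ)_tors`; PRINT {modularity `hmod`, Kato 17.4 (1)(2)@2 `h17`, Greenberg Prop. 4.14@2 `h414`}; DISPLAYED `hper₀`; the KATO HALF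
AT `W` BY NAME (`hK : MainConjectureLowerDivisibilityAtTwoOrd W`, K4's item 19271 at this curve); CERT {`μ_an = 0` (`hμan`),
`2^n ≤ #Sel_{2^∞}(E/ℚ_j)[2]` (`hsel`), `λ_an = n` (`hlan`)} ⟹ `LambdaHalfAtTwo W`. The tower gap of the GEN 0 door is READ from the
Kato half: `X` torsion (Kato) and `μ(X) ≤ μ(ϖ·L₂) = 0` (seat ord's p533609); then `2^n ≤ #Sel[2] ≤ #X/(2,ω_j)X ≤ 2^{λ(X)}` (no finite
submodule, `μ = 0`). No tower gap, no upper count, no Greenberg 4.1, no GZK. [cite: Kato2004Asterisque, Thm. 17.4 (1)(2) (p. 273)]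
[cite: GreenbergLNM1716, §1 p. 60, §3 pp. 85–86, Prop. 4.14] [cite: GreenbergVatsal2000, p. 4 (after Thm. (1.2)) (shape; p odd)] -/
theorem lambdaHalfAtTwo_of_katoHalf_of_analyticMuLE_of_layerSelmer (hmod : nonempty_modularParametrizationData)
    (h17 : ∀ [NeZero (W.conductorNorm ℤ)] (f : CuspForm (Gamma0 (W.conductorNorm ℤ)) 2),
      kato_divisibility_allPrimes W 2 (f := f))
    (h414 : prop414_noFiniteSubmodule_of_not_dvd_torsionOrder)
    (hper₀ : ∀ [NeZero (W.conductorNorm ℤ)] (f : CuspForm (Gamma0 (W.conductorNorm ℤ)) 2),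
      IsNewformOf W f → ∀ ϖ : ℚ, (ϖ : ℝ) * W.realPeriodRat = plusPeriod f → 0 ≤ padicValRat 2 ϖ)
    (hgo : GoodOrd W 2) (htors : ¬ 2 ∣ W.torsionOrder) (hK : MainConjectureLowerDivisibilityAtTwoOrd W)
    (hμan : AnalyticMuLE W 2 0) {j n : ℕ}
    (hsel : ∀ κ : ZpExtension ℚ 2, κ.IsCyclotomic →
      2 ^ n ≤ Nat.card {z : W.selmerLayer κ j // 2 • z = 0})
    (hlan : AnalyticLambdaEq W 2 n) : LambdaHalfAtTwo W :=
  lambdaHalfAtTwo_of_towerGap_of_layerSelmer W hmod h414 hper₀ htors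
    (OrdRedAtTwo.towerGapAtTwo_of_mainConjectureLowerDivisibilityAtTwoOrd_of_analyticMuLE W hmod h17 hgo hK hμan) hsel hlan

/-- **KATO-HALF DOOR on the `E[2]`-IRREDUCIBLE block** (torsion bit and period integrality kernel-free: `Irr W 2` ⟹ `2 ∤ #E(ℚ)_tors`;
Abbes–Ullmo `hAU` ⟹ `hper₀`): PRINT {`hmod`, `h17`, `h414`, `hAU`} + Kato half AT `W` BY NAME + CERT {`μ_an = 0`,
`2^n ≤ #Sel_{2^∞}(E/ℚ_j)[2]`, `λ_an = n`} ⟹ `LambdaHalfAtTwo W`. The door of the 11 no-row classes of this GEN.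
[cite: Kato2004Asterisque, Thm. 17.4 (1)(2) (p. 273)] [cite: AbbesUllmo1996, Thm. A] [cite: GreenbergLNM1716, Prop. 4.14 (§4)] -/
theorem lambdaHalfAtTwo_of_katoHalf_of_analyticMuLE_of_layerSelmer_of_abbesUllmo
    (hmod : nonempty_modularParametrizationData)
    (h17 : ∀ [NeZero (W.conductorNorm ℤ)] (f : CuspForm (Gamma0 (W.conductorNorm ℤ)) 2),
      kato_divisibility_allPrimes W 2 (f := f))
    (h414 : prop414_noFiniteSubmodule_of_not_dvd_torsionOrder)
    (hAU : abbesUllmo_not_dvd_maninConstant_of_not_dvd_level) (hgo : GoodOrd W 2) (hirr : Irr W 2)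
    (hK : MainConjectureLowerDivisibilityAtTwoOrd W) (hμan : AnalyticMuLE W 2 0) {j n : ℕ}
    (hsel : ∀ κ : ZpExtension ℚ 2, κ.IsCyclotomic →
      2 ^ n ≤ Nat.card {z : W.selmerLayer κ j // 2 • z = 0})
    (hlan : AnalyticLambdaEq W 2 n) : LambdaHalfAtTwo W :=
  lambdaHalfAtTwo_of_towerGap_of_layerSelmer_of_abbesUllmo W hmod h414 hAU hgo hirr
    (OrdRedAtTwo.towerGapAtTwo_of_mainConjectureLowerDivisibilityAtTwoOrd_of_analyticMuLE W hmod h17 hgo hK hμan) hsel hlan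

/-- **KATO-HALF DOOR, TOWER currency** (`∃ j, 2^n ≤ #X/(2,T^j)X` at every cyclotomic datum), `E[2]`-irreducible block.
[cite: Kato2004Asterisque, Thm. 17.4 (1)(2) (p. 273)] [cite: GreenbergLNM1716, Prop. 4.14 (§4)] [cite: AbbesUllmo1996, Thm. A] -/
theorem lambdaHalfAtTwo_of_katoHalf_of_analyticMuLE_of_towerRank_of_abbesUllmo
    (hmod : nonempty_modularParametrizationData)
    (h17 : ∀ [NeZero (W.conductorNorm ℤ)] (f : CuspForm (Gamma0 (W.conductorNorm ℤ)) 2),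
      kato_divisibility_allPrimes W 2 (f := f))
    (h414 : prop414_noFiniteSubmodule_of_not_dvd_torsionOrder)
    (hAU : abbesUllmo_not_dvd_maninConstant_of_not_dvd_level) (hgo : GoodOrd W 2) (hirr : Irr W 2)
    (hK : MainConjectureLowerDivisibilityAtTwoOrd W) (hμan : AnalyticMuLE W 2 0) {n : ℕ}
    (hrank : ∀ (κ : ZpExtension ℚ 2) (γ : Field.absoluteGaloisGroup ℚ), κ.IsCyclotomic →
      κ.IsTopGenerator γ → IsCyclotomicVariable 2 γ → ∀ D : W.SelmerDualData κ γ,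
      ∃ j : ℕ, 2 ^ n ≤ Nat.card (D.X ⧸ (towerIdeal 2 j • ⊤ : Submodule (IwasawaAlgebra 2) D.X)))
    (hlan : AnalyticLambdaEq W 2 n) : LambdaHalfAtTwo W :=
  lambdaHalfAtTwo_of_towerGap_of_towerRank_of_abbesUllmo W hmod h414 hAU hgo hirr
    (OrdRedAtTwo.towerGapAtTwo_of_mainConjectureLowerDivisibilityAtTwoOrd_of_analyticMuLE W hmod h17 hgo hK hμan) hrank hlan

/-! ## §2 The Kato half supplied by K4's displayed binders on the `2`-adically surjective habitat -/

/-- **KATO-HALF DOOR at RESERVE tier (`Δ < 0`).** The Kato half AT `W` from K4's displayed RESERVE binder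
`OrdKatoIntAtTwo.KatoReserveWK2AtGoodOrdSurjectiveTwo` (W_K2 Thm. B, review UPHELD 2026-08-07; at `Δ < 0`, `c_∞ = 1` and the binder IS
`MainConjectureLowerDivisibilityAtTwoOrd W`, seat ord's `mainConjectureLowerDivisibilityAtTwoOrd_of_katoReserveWK2_of_Δ_neg`) on a
`2`-adically SURJECTIVE good-ordinary curve with `Δ < 0`; then §1. Binders: RESERVE {`hWK2`} + PRINT {`hmod`, `h17`, `h414`, `hAU`} +
KERNEL {`hgo`, `hirr`, `him`, `hΔ`} + CERT {`μ_an = 0`, `2^n ≤ #Sel_{2^∞}(E/ℚ_j)[2]`, `λ_an = n`}. NOT in print at `p = 2`.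
[cite: Kato2004Asterisque, Thm. 12.4–12.6 (pp. 221–223), Thm. 17.4 (p. 273) (shape)] [cite: Rubin2000, Thm. II.3.8 (ii) (shape)]
[cite: GreenbergLNM1716, Prop. 4.14 (§4)] -/
theorem lambdaHalfAtTwo_of_katoReserveWK2_of_Δ_neg_of_analyticMuLE_of_layerSelmer
    (hWK2 : OrdKatoIntAtTwo.KatoReserveWK2AtGoodOrdSurjectiveTwo) (hmod : nonempty_modularParametrizationData)
    (h17 : ∀ [NeZero (W.conductorNorm ℤ)] (f : CuspForm (Gamma0 (W.conductorNorm ℤ)) 2),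
      kato_divisibility_allPrimes W 2 (f := f))
    (h414 : prop414_noFiniteSubmodule_of_not_dvd_torsionOrder)
    (hAU : abbesUllmo_not_dvd_maninConstant_of_not_dvd_level) (hgo : GoodOrd W 2) (hirr : Irr W 2)
    (him : TwoAdicSurjective W) (hΔ : W.Δ < 0) (hμan : AnalyticMuLE W 2 0) {j n : ℕ}
    (hsel : ∀ κ : ZpExtension ℚ 2, κ.IsCyclotomic →
      2 ^ n ≤ Nat.card {z : W.selmerLayer κ j // 2 • z = 0})
    (hlan : AnalyticLambdaEq W 2 n) : LambdaHalfAtTwo W :=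
  lambdaHalfAtTwo_of_katoHalf_of_analyticMuLE_of_layerSelmer_of_abbesUllmo W hmod h17 h414 hAU hgo hirr
    (OrdKatoIntAtTwo.mainConjectureLowerDivisibilityAtTwoOrd_of_katoReserveWK2_of_Δ_neg W hWK2 hgo him hΔ) hμan hsel hlan

/-- **KATO-HALF DOOR at RESERVE + CELL-MEMO tier (either sign of `Δ`).** The Kato half AT `W` from K4's displayed binder
`OrdKatoIntAtTwo.KatoIntAtGoodOrdSurjectiveTwo` (W_K2 Thm. B for `Δ < 0`, cell MEMO-6 Thm. C for `Δ > 0`; seat ord's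
`mainConjectureLowerDivisibilityAtTwoOrd_of_katoInt`) on a `2`-adically SURJECTIVE good-ordinary curve; then §1. At `Δ > 0` the reserve
binder alone (`char X ∋ g`, `ι g = 2·ϖ·L₂`) bounds `μ(X)` by `1` only, so the count would not bound `λ`: the sharp binder is needed.
[cite: Kato2004Asterisque, Thm. 17.4 (p. 273) and 17.13 (pp. 279–280) (shape)] [cite: GreenbergLNM1716, Prop. 4.14 (§4)] -/
theorem lambdaHalfAtTwo_of_katoInt_of_analyticMuLE_of_layerSelmer
    (hKI : OrdKatoIntAtTwo.KatoIntAtGoodOrdSurjectiveTwo) (hmod : nonempty_modularParametrizationData)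
    (h17 : ∀ [NeZero (W.conductorNorm ℤ)] (f : CuspForm (Gamma0 (W.conductorNorm ℤ)) 2),
      kato_divisibility_allPrimes W 2 (f := f))
    (h414 : prop414_noFiniteSubmodule_of_not_dvd_torsionOrder)
    (hAU : abbesUllmo_not_dvd_maninConstant_of_not_dvd_level) (hgo : GoodOrd W 2) (hirr : Irr W 2)
    (him : TwoAdicSurjective W) (hμan : AnalyticMuLE W 2 0) {j n : ℕ}
    (hsel : ∀ κ : ZpExtension ℚ 2, κ.IsCyclotomic →
      2 ^ n ≤ Nat.card {z : W.selmerLayer κ j // 2 • z = 0})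
    (hlan : AnalyticLambdaEq W 2 n) : LambdaHalfAtTwo W :=
  lambdaHalfAtTwo_of_katoHalf_of_analyticMuLE_of_layerSelmer_of_abbesUllmo W hmod h17 h414 hAU hgo hirr
    (OrdKatoIntAtTwo.mainConjectureLowerDivisibilityAtTwoOrd_of_katoInt W hKI hgo him) hμan hsel hlan

/-! ## §3 For the K4 seats: the `2`-adic main conjecture AT the curve from the Kato half and two finite certificates -/

/-- **Mazur's `2`-adic main conjecture AT `W` from the Kato half AT `W` and two finite certificates** (good ordinary at `2`, odd
torsion order): PRINT {`h17`, `h414`} + DISPLAYED `hper₀` + Kato half AT `W` BY NAME + CERT {`μ_an = 0`, `2^n ≤ #Sel_{2^∞}(E/ℚ_j)[2]`,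
`λ_an = n`} ⟹ `MazurMainConjecture W 2` — the K4 tower road's pinch `KatoHalfPinch.mazurMainConjecture_two_of_towerGap_of_layerSelmer`
with its tower gap READ from the Kato half (p533609): one divisibility `char X ∣ ϖL₂`, `μ` equal (both `0`), `λ` equal
(`λ(X) ≤ λ_an` from the divisibility, `λ_an ≤ λ(X)` from the count) ⟹ equality up to a unit. No layer-`4` descent, no upper count.
[cite: Kato2004Asterisque, Thm. 17.4 (1)(2) (p. 273)] [cite: GreenbergLNM1716, Prop. 4.14 (§4), §3 pp. 85–86] -/
theorem mazurMainConjecture_two_of_katoHalf_of_analyticMuLE_of_layerSelmer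
    (hmod : nonempty_modularParametrizationData)
    (h17 : ∀ [NeZero (W.conductorNorm ℤ)] (f : CuspForm (Gamma0 (W.conductorNorm ℤ)) 2),
      kato_divisibility_allPrimes W 2 (f := f))
    (h414 : prop414_noFiniteSubmodule_of_not_dvd_torsionOrder)
    (hper₀ : ∀ [NeZero (W.conductorNorm ℤ)] (f : CuspForm (Gamma0 (W.conductorNorm ℤ)) 2),
      IsNewformOf W f → ∀ ϖ : ℚ, (ϖ : ℝ) * W.realPeriodRat = plusPeriod f → 0 ≤ padicValRat 2 ϖ)
    (hgo : GoodOrd W 2) (htors : ¬ 2 ∣ W.torsionOrder) (hK : MainConjectureLowerDivisibilityAtTwoOrd W)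
    (hμan : AnalyticMuLE W 2 0) {j n : ℕ}
    (hsel : ∀ κ : ZpExtension ℚ 2, κ.IsCyclotomic →
      2 ^ n ≤ Nat.card {z : W.selmerLayer κ j // 2 • z = 0})
    (hlan : AnalyticLambdaEq W 2 n) : MazurMainConjecture W 2 :=
  KatoHalfPinch.mazurMainConjecture_two_of_towerGap_of_layerSelmer W h17 h414 hper₀ hgo htors
    (OrdRedAtTwo.towerGapAtTwo_of_mainConjectureLowerDivisibilityAtTwoOrd_of_analyticMuLE W hmod h17 hgo hK hμan) hsel hlan hμan

/-- **Mazur's `2`-adic main conjecture AT `W` on the `E[2]`-IRREDUCIBLE block** from the Kato half AT `W` + CERT {`μ_an = 0`,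
saturating count, `λ_an`}: PRINT {`hmod`, `h17`, `h414`, `hAU`}. [cite: Kato2004Asterisque, Thm. 17.4 (1)(2) (p. 273)]
[cite: AbbesUllmo1996, Thm. A] [cite: GreenbergLNM1716, Prop. 4.14 (§4)] -/
theorem mazurMainConjecture_two_of_katoHalf_of_analyticMuLE_of_layerSelmer_of_abbesUllmo
    (hmod : nonempty_modularParametrizationData)
    (h17 : ∀ [NeZero (W.conductorNorm ℤ)] (f : CuspForm (Gamma0 (W.conductorNorm ℤ)) 2),
      kato_divisibility_allPrimes W 2 (f := f))
    (h414 : prop414_noFiniteSubmodule_of_not_dvd_torsionOrder)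
    (hAU : abbesUllmo_not_dvd_maninConstant_of_not_dvd_level) (hgo : GoodOrd W 2) (hirr : Irr W 2)
    (hK : MainConjectureLowerDivisibilityAtTwoOrd W) (hμan : AnalyticMuLE W 2 0) {j n : ℕ}
    (hsel : ∀ κ : ZpExtension ℚ 2, κ.IsCyclotomic →
      2 ^ n ≤ Nat.card {z : W.selmerLayer κ j // 2 • z = 0})
    (hlan : AnalyticLambdaEq W 2 n) : MazurMainConjecture W 2 :=
  mazurMainConjecture_two_of_katoHalf_of_analyticMuLE_of_layerSelmer W hmod h17 h414
    (TowerClass.periodRatio_nonneg_of_irr_two_of_abbesUllmo W hAU hgo hirr)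
    hgo (TowerClass.not_two_dvd_torsionOrder_of_irr W hirr) hK hμan hsel hlan

end Summit.BirchSwinnertonDyer.BirchSwinnertonDyer.Theorems.TwoAdicTwistConverse

end
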